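import Literature.AnabelianGeometry.EtaleTheta.Discharge.Sec5Thm57HsepPowOfOrbitDisplay
import Literature.AnabelianGeometry.EtaleTheta.Discharge.Sec5Thm57HsepRefutedAtModelTate
import Literature.AnabelianGeometry.EtaleTheta.Discharge.Sec2Remark2141NoGoModelTate
import Literature.AnabelianGeometry.EtaleTheta.Discharge.Sec1Prop15iiiOfThetaKummerInput
import Literature.AnabelianGeometry.EtaleTheta.SettingModelTateDeckSignNoGo
import Literature.AnabelianGeometry.EtaleTheta.SettingModelTateInversionXuu
import Mathlib.Tactic.Module
import HarnessLib

/-!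
# [EtTh] §5, Thm. 5.7 (C)-chain: the REPAIRED separation binder `hsep^{(2l)}` is DISCHARGED AT THE TATE DATUM OF RECORD
# `modelχq p 1 2` — for every étale theta datum carrying `η̈♯ = etaDdχq`, every `X̲̲ ∋ (b^{2}, 1)`, every tower, all pairs `η, η'`

S. Mochizuki, *The étale theta function and its Frobenioid-theoretic manifestations*, Publ. RIMS **45** (2009) [EtTh]
(refereed): Prop. 1.5 (ii)/(iii) p. 249 (PDF p. 23), Cor. 2.8 (i) p. 268 (PDF p. 42), Def. 2.13 pp. 272–273 (PDF pp. 46–47)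
[cite: MochizukiEtTh2009, Prop 1.5 (iii) p.249 (PDF p.23); Def 2.13 p.272 (PDF p.46)].
Layer L2 of the abc-iut cell, seat abc-iut-f-123 (gen 8), abc-iut-L2-lead row R983/R1139 «HSEP@TATE-DATUM» (repaired form).

PROOF-ONLY sequel (0 definitions, 0 `Prop` facts) of this seat's `Sec5Thm57HsepPowOfOrbitDisplay` (p500847): its three
print-shaped inputs (D1) exact orbit display, (D2) generator clause at one `k₀ ∈ Δ^tp_Ÿ̲̲`, (D3) centrality at `k₀`, are
DISCHARGED at the stage-2 («Tate shear») model of record `ThetaSetting.modelχq p 1 2` for the étale theta class of record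
`η̈♯ = etaDdχq p 1 2` (abc-iut-L2-t6), all BY NAME over landed theorems:
* (D1) `conj_etaDdχq_display`: **`σ·η̈♯ = η̈♯ · infl(log Ü)^{−2a(σ)} · infl(κ(q̈))^{−a(σ)²}` for EVERY `σ ∈ Π^tp_X`**, `a(σ) = `
  the degree `toZ σ ∈ ℤ` — EXACT, no unit term (the printed `+ log(O^×_K̈)` is absent at this datum): from abc-iut-w6-d076's
  deck-generator powers `conj_deckGen_pow_zClassYddχq` / `…_logUdd` / `…_kumYdd_qddUnit` (p490… `Sec2Remark2141NoGoModelTate`,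
  over abc-iut-L2-t6's deck displays) extended to `ℤ`-powers (`zpow_display_of_pow_display`), the triviality of the
  `Π^tp_Y`-move of `η̈♯` (abc-iut-w5-d095's `conj_etaDdχq_eq_self_of_mem_GtpY`), and the naturality
  `infl ∘ conj^Θ = conj ∘ infl` (`inflTheta_conj_toTheta`); for `σ ∈ Π^tp_X̲̲`, `l ∣ a(σ)` (`map_toZ_Huu`);
* (D2) at `k₀ := (b^{1+1}, 1) ∈ Δ^tp_Ÿ ∩ Π^tp_X̲̲`: the cocycle of `infl(log Ü)|_{Π^tp_Ÿ̲̲}` takes the value `c^{1}` (`yCoordχq_inl_bPowGfp`,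
  `half`), whose `l`-th power reduces to a GENERATOR of `μ_M` under every cyclotome identification (`Ẑ = Ẑ^M·η(ℤ)`,
  `ZHatLevel.level_eq_one_iff_exists_pow`); the Kummer cocycle of `q̈` dies at `k₀` (`coe_kummerContCocycle_qdd_apply`,
  `kappaP_one`);
* (D3) centrality at `k₀` (`conjNormal_toTheta_eq_of_aug_eq_modelχq`, p498173).
MAIN: `hsepPow_modelTate` — at `modelχq p 1 2`, for every `E` with `E.etaDd = etaDdχq p 1 2`, every `C : E.DoubleUnderline l`
with `(b², 1) ∈ Π^tp_X̲̲` (e.g. the `X̲̲` of record `Huuχq`, `hsepPow_modelTate_of_Huuχq`), every `τ`, `hC`, `hS` and EVERY two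
families `η, η'` of theta cocycles with `aug`-inflated ratio (compatible or not), the REPAIRED binder
`∀ M, ∃ d, ∀ k, (η' M k · (η M k)⁻¹)^(2l) = coboundary` HOLDS.  Together with p498173 (`hsep` exponent 2 FALSE at the
same datum for `l ∣ p − 1`) and p498016 (the (C)-chain needs only exponent `2l`), this settles the row: the G-binder
`hsep` of the Thm. 5.7 closers is MISSTATED, and its repaired form is a THEOREM at the Tate datum (binder count −1 there).

HONEST FRAMING. SEMI-SYNTHETIC model (the Tate-sheared χ-twisted root of abc-iut-L2-t5, not the tempered `π₁` of a curve):
consistency / instance evidence for the typed interface only; nothing of [EtTh] is asserted; typed ≠ proved;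
discharged-at-a-model ≠ discharged; no side is taken on [IUTchIII] Cor. 3.12.
-/

noncomputable section

namespace Literature.AnabelianGeometry.EtaleTheta

open Literature.AnabelianGeometry.SemiGraphs
open scoped IsMulCommutative

/-! ### `ℤ`-powers from `ℕ`-powers for a conjugation display -/

/-- From the displays along the NON-NEGATIVE powers of one element `g` — `gⁿ·Q = Q`, `gⁿ·L = L·Qⁿ`, `gⁿ·x = x·L^{−2n}·Q^{−n²}`
— the display along ALL powers: `g^a·x = x·L^{−2a}·Q^{−a²}` (`a ∈ ℤ`), for any action `ρ` of a group on a commutative group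
by endomorphisms (Prop. 1.5 (iii): "`a ∈ Z` acts … as follows"). [cite: MochizukiEtTh2009, Prop 1.5 (iii) p.249 (PDF p.23)] -/
theorem zpow_display_of_pow_display {G H : Type*} [Group G] [CommGroup H] (ρ : G → (H →* H))
    (hone : ∀ x, ρ 1 x = x) (hmul : ∀ σ τ x, ρ (σ * τ) x = ρ σ (ρ τ x)) (g : G) (x L Q : H)
    (hQ : ∀ n : ℕ, ρ (g ^ n) Q = Q) (hL : ∀ n : ℕ, ρ (g ^ n) L = L * Q ^ (n : ℤ))
    (hx : ∀ n : ℕ, ρ (g ^ n) x = x * L ^ (-(2 * (n : ℤ))) * Q ^ (-((n : ℤ) ^ 2))) (a : ℤ) :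
    ρ (g ^ a) x = x * L ^ (-(2 * a)) * Q ^ (-(a ^ 2)) := by
  obtain ⟨n, rfl | rfl⟩ := Int.eq_nat_or_neg a
  · rw [zpow_natCast]; exact hx n
  · have hinj : Function.Injective (ρ (g ^ n)) := fun u v huv => by
      have h := congrArg (ρ (g ^ n)⁻¹) huv
      rwa [← hmul, ← hmul, inv_mul_cancel, hone, hone] at h
    apply hinj
    rw [← hmul, zpow_neg, zpow_natCast, mul_inv_cancel, hone, map_mul, map_mul, map_zpow, map_zpow, hx n, hL n, hQ n]
    apply Additive.ofMul.injective
    simp only [ofMul_mul, ofMul_zpow]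
    module

namespace SettingModel

variable (p : ℕ) [Fact p.Prime]

/-! ### (D1) The exact orbit display of `η̈♯ = etaDdχq` at `modelχq p 1 2`, for every `σ ∈ Π^tp_X` -/

/-- **`σ₀^a · x′ = x′ · log(Ü)^{−2a} · κ(q̈)^{−a²}` for every `a ∈ ℤ`** (`x′ = zClassYddχq p 1 2` the lift of `η̈♯`, `σ₀ = (a, 1)`
the deck generator): abc-iut-w6-d076's `ℕ`-power displays extended to negative powers.
[cite: MochizukiEtTh2009, Prop 1.5 (iii) p.249 (PDF p.23)] -/
theorem conj_deckGen_zpow_zClassYddχq (hC : (ThetaSetting.modelχq p 1 2 even_two).Compat) (a : ℤ) :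
    haveI := hC.GtpYddTheta_normal
    ContH1.conj (MonoidHom.id (ThetaSetting.modelχq p 1 2 even_two).GtpTheta)
        (ThetaSetting.modelχq p 1 2 even_two).DeltaTheta
        ((ThetaSetting.modelχq p 1 2 even_two).toTheta
          ((SemidirectProduct.inl (gfpOf (FreeGroup.of 0)) : PiTpχq p 1 2) ^ a))
        (zClassYddχq p 1 2 even_two) =
      zClassYddχq p 1 2 even_two * (kummerCoreχq p 1 2 even_two).logUdd ^ (-(2 * a)) *
        (kummerCoreχq p 1 2 even_two).toKummerData.kumYdd
          ((kummerCoreχq p 1 2 even_two).toKummerData.toKddHat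
            (ThetaSetting.modelχq p 1 2 even_two).qddUnit) ^ (-(a ^ 2)) := by
  haveI := hC.GtpYddTheta_normal
  have h := zpow_display_of_pow_display
    (fun g : PiTpχq p 1 2 => ContH1.conj (MonoidHom.id (ThetaSetting.modelχq p 1 2 even_two).GtpTheta)
      (ThetaSetting.modelχq p 1 2 even_two).DeltaTheta ((ThetaSetting.modelχq p 1 2 even_two).toTheta g))
    (fun x => by simp only [map_one, ContH1.conj_one_apply])
    (fun σ τ x => by simp only [map_mul, ContH1.conj_mul_apply])
    (SemidirectProduct.inl (gfpOf (FreeGroup.of 0)) : PiTpχq p 1 2) (zClassYddχq p 1 2 even_two)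
    (kummerCoreχq p 1 2 even_two).logUdd
    ((kummerCoreχq p 1 2 even_two).toKummerData.kumYdd
      ((kummerCoreχq p 1 2 even_two).toKummerData.toKddHat (ThetaSetting.modelχq p 1 2 even_two).qddUnit))
    (conj_deckGen_pow_kumYdd_qddUnit p hC) (conj_deckGen_pow_logUdd p hC) (conj_deckGen_pow_zClassYddχq p hC) a
  exact h

/-- The degree of `σ₀^a` is `a`. [cite: MochizukiEtTh2009, Prop 1.5 (iii) p.249 (PDF p.23)] -/
theorem toAdd_toZ_deckGen_zpow (a : ℤ) :
    Multiplicative.toAdd ((ThetaSetting.modelχq p 1 2 even_two).toZ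
      ((SemidirectProduct.inl (gfpOf (FreeGroup.of 0)) : PiTpχq p 1 2) ^ a)) = a := by
  rw [map_zpow, toZ_inl_gfpOf_a, toAdd_zpow, toAdd_ofAdd, smul_eq_mul, mul_one]

/-- **(D1) The EXACT orbit display at the Tate datum of record**: for EVERY `σ ∈ Π^tp_X` of `modelχq p 1 2`,
`σ·η̈♯ = η̈♯ · infl(log Ü)^{−2a} · infl(κ(q̈))^{−a²}` in `H¹(Π^tp_Ÿ, Δ_Θ)` with `a = toZ σ` — Prop. 1.5 (iii)'s display with the
unit term EQUAL TO `1` (write `σ = σ₀^a·y` with `y ∈ Π^tp_Y`, which fixes `η̈♯`; then `conj_deckGen_zpow_zClassYddχq` through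
`infl ∘ conj^Θ = conj ∘ infl`). [cite: MochizukiEtTh2009, Prop 1.5 (iii) p.249 (PDF p.23)] -/
theorem conj_etaDdχq_display (hC : (ThetaSetting.modelχq p 1 2 even_two).Compat) (σ : PiTpχq p 1 2) :
    haveI := hC.GtpYdd_normal
    ContH1.conj (ThetaSetting.modelχq p 1 2 even_two).toTheta (ThetaSetting.modelχq p 1 2 even_two).DeltaTheta σ
        (etaDdχq p 1 2 even_two) =
      etaDdχq p 1 2 even_two *
        (ThetaSetting.modelχq p 1 2 even_two).inflTheta (ThetaSetting.modelχq p 1 2 even_two).GtpYdd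
          (kummerCoreχq p 1 2 even_two).logUdd ^
            (-(2 * Multiplicative.toAdd ((ThetaSetting.modelχq p 1 2 even_two).toZ σ))) *
        (ThetaSetting.modelχq p 1 2 even_two).inflTheta (ThetaSetting.modelχq p 1 2 even_two).GtpYdd
          ((kummerCoreχq p 1 2 even_two).toKummerData.kumYdd
            ((kummerCoreχq p 1 2 even_two).toKummerData.toKddHat
              (ThetaSetting.modelχq p 1 2 even_two).qddUnit)) ^
            (-(Multiplicative.toAdd ((ThetaSetting.modelχq p 1 2 even_two).toZ σ) ^ 2)) := by
  haveI := hC.GtpYdd_normal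
  haveI := hC.GtpYddTheta_normal
  set a : ℤ := Multiplicative.toAdd ((ThetaSetting.modelχq p 1 2 even_two).toZ σ) with ha
  set g : PiTpχq p 1 2 := (SemidirectProduct.inl (gfpOf (FreeGroup.of 0)) : PiTpχq p 1 2) ^ a with hg
  -- `σ = σ₀^a · y` with `y ∈ Π^tp_Y`
  have hy : g⁻¹ * σ ∈ (ThetaSetting.modelχq p 1 2 even_two).GtpY := by
    change g⁻¹ * σ ∈ (ThetaSetting.modelχq p 1 2 even_two).toZ.ker
    rw [MonoidHom.mem_ker, map_mul, map_inv]
    apply Multiplicative.toAdd.injective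
    rw [toAdd_mul, toAdd_inv, hg, toAdd_toZ_deckGen_zpow, ← ha, toAdd_one, neg_add_cancel]
  have hσ : σ = g * (g⁻¹ * σ) := (mul_inv_cancel_left g σ).symm
  rw [hσ, ContH1.conj_mul_apply, conj_etaDdχq_eq_self_of_mem_GtpY p 1 2 even_two hC hy, etaDdχq_def,
    ← ThetaSetting.inflTheta_conj_toTheta hC, hg, conj_deckGen_zpow_zClassYddχq p hC a, map_mul, map_mul, map_zpow,
    map_zpow]

/-- For `σ ∈ Π^tp_X̲̲`, the degree `toZ σ` is divisible by `l` (`toZ(Π^tp_X̲̲) = l·ℤ`, Def. 2.5 (i)).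
[cite: MochizukiEtTh2009, Def 2.5 (i) p.265 (PDF p.39)] -/
theorem _root_.Literature.AnabelianGeometry.EtaleTheta.ThetaSetting.EtaleThetaData.DoubleUnderline.dvd_toAdd_toZ_of_mem_Huu
    {D : ThetaSetting p} {E : D.EtaleThetaData} {l : ℕ} (C : E.DoubleUnderline l) {σ : D.PiTemp} (hσ : σ ∈ C.Huu) :
    (l : ℤ) ∣ Multiplicative.toAdd (D.toZ σ) := by
  have hmem : D.toZ σ ∈ C.Huu.map D.toZ := ⟨σ, hσ, rfl⟩
  rw [C.map_toZ_Huu, Subgroup.mem_zpowers_iff] at hmem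
  obtain ⟨k, hk⟩ := hmem
  refine ⟨k, ?_⟩
  rw [← hk, toAdd_zpow, toAdd_ofAdd, smul_eq_mul, mul_comm]

/-! ### (D2)/(D3) at `k₀ := (b^{1+1}, 1) ∈ Δ^tp_Ÿ ∩ Π^tp_X̲̲` -/

/-- `(b^{w·w}, 1) ∈ Π^tp_Ÿ` at the stage-2 model (its `y`-coordinate `w·w` is even at level `2`; stage-2 analogue of
abc-iut-L2-t12's `inl_bPowGfp_mul_self_mem_GtpYdd`). [cite: MochizukiEtTh2009, §1 p.243 (PDF p.17)] -/
theorem inl_bPowGfp_mul_self_mem_GtpYdd_modelχq (i j : ℤ) (hj : Even j) (w : ZH) :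
    (SemidirectProduct.inl (bPowGfp (w * w)) : PiTpχq p i j) ∈ (ThetaSetting.modelχq p i j hj).GtpYdd := by
  rw [GtpYdd_modelχq]
  refine (GfpTwistData₀.mem_YN _).mpr ⟨?_, by rw [SemidirectProduct.right_inl]; exact one_mem _⟩
  rw [SemidirectProduct.left_inl, bPowGfp_mem_dY_iff, map_mul]
  generalize ZHatLevel.level 2 w = c
  rw [← ofAdd_toAdd c, ← ofAdd_add, ← two_nsmul]
  change Multiplicative.ofAdd ((2 : ℕ) • Multiplicative.toAdd c) = 1
  rw [nsmul_eq_mul]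
  have h2 : ((2 : ℕ) : ZMod (2 : ℕ+)) = 0 := by decide
  rw [h2, zero_mul, ofAdd_zero]

/-- `(b^t, 1) ∈ Π^tp_X̲̲ = Huuχq` of record (the `b`-axis lies in `dUU l`; local copy of abc-iut-w5-d043's
`inl_bPowGfp_mem_Huuχq`, `Sec2Cor219iiiHgenParityAtModelChi`, not imported here). [cite: MochizukiEtTh2009, Def 2.5 (i) p.265 (PDF p.39)] -/
private theorem inl_bPowGfp_mem_Huuχq_record (i j : ℤ) (l : ℕ+) (hl : Odd (l : ℕ)) (t : ZH) :
    (SemidirectProduct.inl (bPowGfp t) : PiTpχq p i j) ∈ Huuχq p i j l hl :=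
  (inl_mem_Huuχq_iff p i j l hl _).mpr (bPowGfp_mem_dUU l t)

/-- **The generator clause for `Ẑ → Δ_Θ ↠ μ_M`**: for every cyclotome identification `μ` at level `M` of the stage-2 model,
`red_M((c^{η(1)})^l)` GENERATES `μ_M` (`Ẑ = Ẑ^M · η(ℤ)`: every `t ∈ Ẑ` is `s^M · η(1)^k`, so every element of `l·Δ_Θ = c^{l·Ẑ}`
reduces to a power of `red_M(c^{l·η(1)})`). [cite: MochizukiEtTh2009, §1 p.238 (PDF p.12); Def 2.13 p.272 (PDF p.46)] -/
theorem red_deltaThetaCoordχq_eta_pow_generates (i j : ℤ) (hj : Even j) {l : ℕ} {M : ℕ+}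
    (μ : (ThetaSetting.modelχq p i j hj).CyclotomeMod l M) (e : (ThetaSetting.modelχq p i j hj).DeltaTheta)
    (he : e = deltaThetaCoordχq p i j (ZHatLevel.eta 1)) (x : MuN p M) :
    x ∈ Subgroup.zpowers (μ.red ⟨((e ^ l : (ThetaSetting.modelχq p i j hj).DeltaTheta) :
      (ThetaSetting.modelχq p i j hj).GtpTheta), ⟨e, e.2, rfl⟩⟩) := by
  subst he
  obtain ⟨X, rfl⟩ := μ.red_surjective x
  obtain ⟨y, hy, hyX⟩ := X.2
  obtain ⟨t, ht⟩ := (bijective_deltaThetaCoordχq p i j).2 ⟨y, hy⟩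
  have hy' : ((deltaThetaCoordχq p i j t : (CurveTheta.thetaToEll (curveχq p i j)).ker) :
      CurveTheta.GTheta (curveχq p i j)) = y := congrArg Subtype.val ht
  -- `t = s^M · η(1)^k`
  obtain ⟨k, hk⟩ := ZHatLevel.exists_level_eq_level_eta M t
  have h1 : ZHatLevel.level M (t * (ZHatLevel.eta k)⁻¹) = 1 := by rw [map_mul, map_inv, hk, mul_inv_cancel]
  obtain ⟨s, hs⟩ := (ZHatLevel.level_eq_one_iff_exists_pow M _).1 h1
  have ht' : t = s ^ (M : ℕ) * ZHatLevel.eta 1 ^ k := by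
    rw [← ZHatLevel.eta_eq_zpow, hs, inv_mul_cancel_right]
  -- the identity in the commutative group `Δ_Θ = Ker(Δ^Θ ↠ Δ^ell)` of the model
  have hΔ : (deltaThetaCoordχq p i j t) ^ l =
      ((deltaThetaCoordχq p i j s) ^ l) ^ (M : ℕ) * ((deltaThetaCoordχq p i j (ZHatLevel.eta 1)) ^ l) ^ k := by
    rw [ht', map_mul, map_pow, map_zpow, mul_pow, ← pow_mul, mul_comm (M : ℕ) l, pow_mul,
      ← zpow_natCast (deltaThetaCoordχq p i j (ZHatLevel.eta 1) ^ k) l, ← zpow_mul, mul_comm k,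
      zpow_mul, zpow_natCast]
  -- the element of `l·Δ_Θ` written through `s` and `η(1)`
  have hX : X = (⟨(((deltaThetaCoordχq p i j s : (ThetaSetting.modelχq p i j hj).DeltaTheta) ^ l :
        (ThetaSetting.modelχq p i j hj).DeltaTheta) : (ThetaSetting.modelχq p i j hj).GtpTheta),
        ⟨deltaThetaCoordχq p i j s, (deltaThetaCoordχq p i j s).2, rfl⟩⟩ : (ThetaSetting.modelχq p i j hj).lDeltaTheta l) ^
          (M : ℕ) *
      (⟨(((deltaThetaCoordχq p i j (ZHatLevel.eta 1) : (ThetaSetting.modelχq p i j hj).DeltaTheta) ^ l :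
        (ThetaSetting.modelχq p i j hj).DeltaTheta) : (ThetaSetting.modelχq p i j hj).GtpTheta),
        ⟨deltaThetaCoordχq p i j (ZHatLevel.eta 1), (deltaThetaCoordχq p i j (ZHatLevel.eta 1)).2, rfl⟩⟩ :
          (ThetaSetting.modelχq p i j hj).lDeltaTheta l) ^ k := by
    apply Subtype.ext
    have h2 := congrArg (fun z : (CurveTheta.thetaToEll (curveχq p i j)).ker => (z : CurveTheta.GTheta (curveχq p i j))) hΔ
    simp only [Subgroup.coe_mul, SubmonoidClass.coe_pow, SubgroupClass.coe_zpow] at h2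
    rw [hy', hyX] at h2
    rw [h2]
    simp only [Subgroup.coe_mul, SubmonoidClass.coe_pow, SubgroupClass.coe_zpow]
  rw [hX, map_mul, map_pow, map_zpow]
  have hM : ∀ z : MuN p M, z ^ (M : ℕ) = 1 := fun z => by
    have h := pow_card_eq_one (G := MuN p M) (x := z)
    rwa [card_MuN] at h
  rw [hM, one_mul]
  exact ⟨k, rfl⟩

/-- The `Ẑ → Δ_Θ` coordinate of abc-iut-w5-d171's `y`-coordinate kit is `deltaThetaCoordχq` (bookkeeping).
[cite: MochizukiEtTh2009, §1 p.238 (PDF p.12)] -/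
theorem iota_yCoordKitχq (i j : ℤ) (hj : Even j) : (yCoordKitχq p i j hj).iota = deltaThetaCoordχq p i j := rfl

/-- The `y`-coordinate of the kit is `yThetaχq` (bookkeeping). [cite: MochizukiEtTh2009, Prop 1.5 (ii) p.249 (PDF p.23)] -/
theorem y_yCoordKitχq (i j : ℤ) (hj : Even j) : (yCoordKitχq p i j hj).y = yThetaχq p i j := rfl

/-- **The `log(Ü)`-cocycle at `(b^{t·t}, 1)` is `c^t`** (`ŷ(b^{t·t}) = t·t`, halved in `Ẑ`).
[cite: MochizukiEtTh2009, Prop 1.5 (ii) p.249 (PDF p.23)] -/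
theorem logUddFun_inl_bPowGfp_mul_self (i j : ℤ) (hj : Even j) (t : ZH)
    (hmem : (ThetaSetting.modelχq p i j hj).toTheta (SemidirectProduct.inl (bPowGfp (t * t)) : PiTpχq p i j) ∈
      (ThetaSetting.modelχq p i j hj).GtpYdd.map (ThetaSetting.modelχq p i j hj).toTheta) :
    (yCoordKitχq p i j hj).logUddFun ⟨_, hmem⟩ = deltaThetaCoordχq p i j t := by
  unfold ThetaSetting.YCoordKit.logUddFun
  rw [iota_yCoordKitχq]
  refine congrArg (deltaThetaCoordχq p i j) ?_
  apply sqHom_injective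
  rw [sqHom_apply, sqHom_apply, half_sq]
  show (yCoordKitχq p i j hj).y (CurveTheta.toTheta (curveχq p i j) (SemidirectProduct.inl (bPowGfp (t * t)))) = t ^ 2
  rw [y_yCoordKitχq, yThetaχq_toTheta, yCoordχq_inl_bPowGfp, pow_two]

/-- **A cocycle representative of `infl(log Ü)|_{Π^tp_Ÿ̲̲}`** at `modelχq p 1 2` (the restricted inflation of abc-iut-w5-d171's
`logUddFun`), with its value at any element `(b^{t·t}, 1)`: `c^{t}` (`ŷ(b^{t·t}) = t·t`, halved).
[cite: MochizukiEtTh2009, Prop 1.5 (ii) p.249 (PDF p.23)] -/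
theorem exists_logUdd_repr_modelTate {E : (ThetaSetting.modelχq p 1 2 even_two).EtaleThetaData} {l : ℕ}
    (C : E.DoubleUnderline l) :
    ∃ (lf : C.GtpYdduu → (ThetaSetting.modelχq p 1 2 even_two).DeltaTheta)
      (hlf : lf ∈ contCocycles (ThetaSetting.modelχq p 1 2 even_two).toTheta
        (ThetaSetting.modelχq p 1 2 even_two).DeltaTheta C.GtpYdduu),
      ContH1.mk lf hlf = ContH1.res (ThetaSetting.modelχq p 1 2 even_two).toTheta
        (ThetaSetting.modelχq p 1 2 even_two).DeltaTheta inf_le_left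
        ((ThetaSetting.modelχq p 1 2 even_two).inflTheta (ThetaSetting.modelχq p 1 2 even_two).GtpYdd
          (kummerCoreχq p 1 2 even_two).logUdd) ∧
      ∀ (t : ZH) (h : C.GtpYdduu), (h : PiTpχq p 1 2) = SemidirectProduct.inl (bPowGfp (t * t)) →
        lf h = deltaThetaCoordχq p 1 2 t := by
  let LF := ContH1.resCocycle (ThetaSetting.modelχq p 1 2 even_two).toTheta (ThetaSetting.modelχq p 1 2 even_two).DeltaTheta
    (inf_le_left : C.GtpYdduu ≤ (ThetaSetting.modelχq p 1 2 even_two).GtpYdd)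
    (ContH1.inflCocycle (ThetaSetting.modelχq p 1 2 even_two).DeltaTheta (ThetaSetting.modelχq p 1 2 even_two).toTheta
      (ThetaSetting.modelχq p 1 2 even_two).continuous_toTheta le_rfl
      ⟨(yCoordKitχq p 1 2 even_two).logUddFun, (yCoordKitχq p 1 2 even_two).logUddFun_mem⟩)
  refine ⟨LF.1, LF.2, ?_, fun t h hh => ?_⟩
  · -- `log(Ü)` of the Kummer core of record IS the class of `logUddFun` (abc-iut-w5-d171), so both sides are the class of
    -- the same restricted–inflated cocycle
    change ContH1.mk LF.1 LF.2 = ContH1.res (ThetaSetting.modelχq p 1 2 even_two).toTheta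
      (ThetaSetting.modelχq p 1 2 even_two).DeltaTheta inf_le_left
      ((ThetaSetting.modelχq p 1 2 even_two).inflTheta (ThetaSetting.modelχq p 1 2 even_two).GtpYdd
        (ContH1.mk (yCoordKitχq p 1 2 even_two).logUddFun (yCoordKitχq p 1 2 even_two).logUddFun_mem))
    rfl
  obtain ⟨h₀, hh₀⟩ := h
  change (h₀ : PiTpχq p 1 2) = _ at hh
  subst hh
  exact logUddFun_inl_bPowGfp_mul_self p 1 2 even_two t _

/-- **A cocycle representative of `infl(κ(q̈))|_{Π^tp_Ÿ̲̲}`** at `modelχq p i j` (the restricted inflation of the Kummer cocycle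
of the `N`-th roots of record of `q̈ = p`), which DIES on `Δ^tp` (its value at `h` is `c^{κ_p(aug h)}`).
[cite: MochizukiEtTh2009, Prop 1.5 (ii) p.249 (PDF p.23)] -/
theorem exists_kumYdd_qdd_repr_modelTate (i j : ℤ) (hj : Even j)
    {E : (ThetaSetting.modelχq p i j hj).EtaleThetaData} {l : ℕ} (C : E.DoubleUnderline l) :
    ∃ (qf : C.GtpYdduu → (ThetaSetting.modelχq p i j hj).DeltaTheta)
      (hqf : qf ∈ contCocycles (ThetaSetting.modelχq p i j hj).toTheta
        (ThetaSetting.modelχq p i j hj).DeltaTheta C.GtpYdduu),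
      ContH1.mk qf hqf = ContH1.res (ThetaSetting.modelχq p i j hj).toTheta
        (ThetaSetting.modelχq p i j hj).DeltaTheta inf_le_left
        ((ThetaSetting.modelχq p i j hj).inflTheta (ThetaSetting.modelχq p i j hj).GtpYdd
          ((kummerCoreχq p i j hj).toKummerData.kumYdd
            ((kummerCoreχq p i j hj).toKummerData.toKddHat (ThetaSetting.modelχq p i j hj).qddUnit))) ∧
      ∀ h : C.GtpYdduu, (ThetaSetting.modelχq p i j hj).aug (h : PiTpχq p i j) = 1 → qf h = 1 := by
  letI := (ThetaSetting.modelχq p i j hj).unitsAction (kummerCoreχq p i j hj).augTheta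
  let QF := ContH1.resCocycle (ThetaSetting.modelχq p i j hj).toTheta (ThetaSetting.modelχq p i j hj).DeltaTheta
    (inf_le_left : C.GtpYdduu ≤ (ThetaSetting.modelχq p i j hj).GtpYdd)
    (ContH1.inflCocycle (ThetaSetting.modelχq p i j hj).DeltaTheta (ThetaSetting.modelχq p i j hj).toTheta
      (ThetaSetting.modelχq p i j hj).continuous_toTheta le_rfl
      ((kummerCoreχq p i j hj).coeff.kummerContCocycle
        ((ThetaSetting.modelχq p i j hj).GtpYdd.map (ThetaSetting.modelχq p i j hj).toTheta)
        ((pRoots p).cast (pUnit_eq_toInvYdd_qddUnit p i j hj))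
        ((kummerCoreχq p i j hj).toInvYdd (ThetaSetting.modelχq p i j hj).qddUnit).2
        (fun _ => (kummerCoreχq p i j hj).isOpen_stabilizer' _)))
  refine ⟨QF.1, QF.2, ?_, fun h hh => ?_⟩
  · rw [kumYdd_toKddHat_qddUnit_eq_mk]
    rfl
  · apply Subtype.ext
    have hval := coe_kummerContCocycle_qdd_apply p i j hj
      ⟨(ThetaSetting.modelχq p i j hj).toTheta (h : PiTpχq p i j), ⟨h, (Subgroup.mem_inf.1 h.2).1, rfl⟩⟩
    have hr : (h : PiTpχq p i j).right = 1 := hh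
    rw [show CurveTheta.augTheta (curveχq p i j) ((ThetaSetting.modelχq p i j hj).toTheta (h : PiTpχq p i j)) =
        (h : PiTpχq p i j).right from CurveTheta.augTheta_toTheta (curveχq p i j) _, hr, kappaP_one, map_one] at hval
    exact hval

/-! ### Main theorem: `hsep^{(2l)}` at the Tate datum of record -/

/-- **The repaired separation binder `hsep^{(2l)}` HOLDS at the [EtTh] model of record `modelχq p 1 2`**: for every étale theta
datum `E` with `E.etaDd = etaDdχq p 1 2` (e.g. abc-iut-w5-d171's `etaleThetaDataχqInr p`), every `C : E.DoubleUnderline l` whose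
`Π^tp_X̲̲` contains `k₀ = (b^{η(1)·η(1)}, 1)` (e.g. the `X̲̲` of record, `hsepPow_modelTate_of_Huuχq`), every cyclotome tower `τ`,
all `hC`/`hS`, EVERY two families `η, η'` of members of the collections of theta cocycles of `C.thetaEnvTower τ hC hS` with
`aug`-inflated ratio, and every level `M ∈ Es`: `(η' M k·(η M k)⁻¹)^{2l}` is a `μ_M`-coboundary — the binder of
`ThetaEnvTower.etaleTorsion_of_cor219iiiStd_of_hsepPow` (p498016) DISCHARGED at the datum (its exponent-`2` original is FALSE
there for `l ∣ p − 1`, p498173). [cite: MochizukiEtTh2009, Prop 1.5 (iii) p.249 (PDF p.23); Def 2.13 p.272 (PDF p.46)] -/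
theorem hsepPow_modelTate (hC : (ThetaSetting.modelχq p 1 2 even_two).Compat)
    (hS : (ThetaSetting.modelχq p 1 2 even_two).Sec2Hyps)
    {E : (ThetaSetting.modelχq p 1 2 even_two).EtaleThetaData} (hE : E.etaDd = etaDdχq p 1 2 even_two) {l : ℕ}
    (C : E.DoubleUnderline l)
    (hk₀ : (SemidirectProduct.inl (bPowGfp (ZHatLevel.eta 1 * ZHatLevel.eta 1)) : PiTpχq p 1 2) ∈ C.Huu)
    {Es : Set ℕ+} (τ : (ThetaSetting.modelχq p 1 2 even_two).CyclotomeTower l Es)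
    (η η' : ∀ M : Es, (C.thetaEnvTower τ hC hS).PiYdd → (C.thetaEnvTower τ hC hS).mu M)
    (hη : ∀ M, η M ∈ (C.thetaEnvTower τ hC hS).thetaCocycles M)
    (hη' : ∀ M, η' M ∈ (C.thetaEnvTower τ hC hS).thetaCocycles M)
    (hinfl : ∀ (M : Es) (k k' : (C.thetaEnvTower τ hC hS).PiYdd),
      (C.thetaEnvTower τ hC hS).aug k = (C.thetaEnvTower τ hC hS).aug k' → η' M k * (η M k)⁻¹ = η' M k' * (η M k')⁻¹)
    (M : Es) :
    ∃ d : (C.thetaEnvTower τ hC hS).mu M, ∀ k : (C.thetaEnvTower τ hC hS).PiYdd,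
      (η' M k * (η M k)⁻¹) ^ (2 * l) =
        CycEnvelope.coboundary ((C.thetaEnvTower τ hC hS).aug.comp (C.thetaEnvTower τ hC hS).PiYdd.subtype)
          ((C.thetaEnvTower τ hC hS).chi M) d k := by
  classical
  haveI := hC.GtpYdd_normal
  -- the element `k₀ = (b^{η(1)·η(1)}, 1) ∈ Δ^tp_Ÿ ∩ Π^tp_X̲̲`
  have hk₀Y := inl_bPowGfp_mul_self_mem_GtpYdd_modelχq p 1 2 even_two (ZHatLevel.eta 1)
  let k₀ : (ThetaSetting.modelχq p 1 2 even_two).GtpYdd.subgroupOf C.Huu := ⟨⟨_, hk₀⟩, hk₀Y⟩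
  have haug₀ : (ThetaSetting.modelχq p 1 2 even_two).aug ((k₀ : C.Huu) : (ThetaSetting.modelχq p 1 2 even_two).PiTemp) = 1 := by
    show (SemidirectProduct.inl (bPowGfp (ZHatLevel.eta 1 * ZHatLevel.eta 1)) : PiTpχq p 1 2).right = 1
    exact SemidirectProduct.right_inl _
  -- the representatives (D2) and their values at `k₀`
  obtain ⟨lf, hlf, hlfc, hlfv⟩ := exists_logUdd_repr_modelTate p C
  obtain ⟨qf, hqf, hqfc, hqfv⟩ := exists_kumYdd_qdd_repr_modelTate p 1 2 even_two C
  have hlf₀ : lf (C.inclYdduu k₀) = deltaThetaCoordχq p 1 2 (ZHatLevel.eta 1) := hlfv _ _ rfl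
  refine C.hsepPow_of_orbitDisplay τ hC hS _ _
    (fun σ => Multiplicative.toAdd ((ThetaSetting.modelχq p 1 2 even_two).toZ σ))
    (fun σ hσ => C.dvd_toAdd_toZ_of_mem_Huu p hσ)
    (fun σ _ => by rw [hE]; exact conj_etaDdχq_display p hC σ)
    lf hlf hlfc qf hqf hqfc k₀ haug₀
    (fun M' x => red_deltaThetaCoordχq_eta_pow_generates p 1 2 even_two (τ.mod M') _ hlf₀ x)
    (hqfv _ haug₀) (fun e => ?_) η η' hη hη' hinfl M
  -- (D3) centrality at `k₀`
  rw [conjNormal_toTheta_eq_of_aug_eq_modelχq p 1 2 even_two _ 1 e (by rw [haug₀, map_one]), map_one, map_one,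
    MulAut.one_apply]

/-- **Corollary for the `X̲̲` of record** (`C.Huu = Huuχq p 1 2 l hl`, which contains the whole `b`-axis): `hsep^{(2l)}` holds at
the Tate datum for every `E` with `E.etaDd = etaDdχq p 1 2`, every such `C`, every `τ`, all pairs `η, η'`.
[cite: MochizukiEtTh2009, Prop 1.5 (iii) p.249 (PDF p.23); Def 2.13 p.272 (PDF p.46)] -/
theorem hsepPow_modelTate_of_Huuχq (hC : (ThetaSetting.modelχq p 1 2 even_two).Compat)
    (hS : (ThetaSetting.modelχq p 1 2 even_two).Sec2Hyps)
    {E : (ThetaSetting.modelχq p 1 2 even_two).EtaleThetaData} (hE : E.etaDd = etaDdχq p 1 2 even_two) {l : ℕ+}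
    {hl : Odd (l : ℕ)} (C : E.DoubleUnderline l) (hCrec : C.Huu = Huuχq p 1 2 l hl)
    {Es : Set ℕ+} (τ : (ThetaSetting.modelχq p 1 2 even_two).CyclotomeTower l Es)
    (η η' : ∀ M : Es, (C.thetaEnvTower τ hC hS).PiYdd → (C.thetaEnvTower τ hC hS).mu M)
    (hη : ∀ M, η M ∈ (C.thetaEnvTower τ hC hS).thetaCocycles M)
    (hη' : ∀ M, η' M ∈ (C.thetaEnvTower τ hC hS).thetaCocycles M)
    (hinfl : ∀ (M : Es) (k k' : (C.thetaEnvTower τ hC hS).PiYdd),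
      (C.thetaEnvTower τ hC hS).aug k = (C.thetaEnvTower τ hC hS).aug k' → η' M k * (η M k)⁻¹ = η' M k' * (η M k')⁻¹)
    (M : Es) :
    ∃ d : (C.thetaEnvTower τ hC hS).mu M, ∀ k : (C.thetaEnvTower τ hC hS).PiYdd,
      (η' M k * (η M k)⁻¹) ^ (2 * (l : ℕ)) =
        CycEnvelope.coboundary ((C.thetaEnvTower τ hC hS).aug.comp (C.thetaEnvTower τ hC hS).PiYdd.subtype)
          ((C.thetaEnvTower τ hC hS).chi M) d k :=
  hsepPow_modelTate p hC hS hE C (hCrec ▸ inl_bPowGfp_mem_Huuχq_record p 1 2 l hl _) τ η η' hη hη' hinfl M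

end SettingModel

end Literature.AnabelianGeometry.EtaleTheta

end
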